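import Literature.Probability.RandomPlanarGeometry.ObliqueRBMWedgeDynkin
import HarnessLib

/-!
# The Dynkin identity of the canonical obliquely reflected Brownian motion, stopped at a level

Layer of the proof of
`Literature.Probability.RandomPlanarGeometry.LawlerSchrammWerner2001_orbm_uniformHitting`
(`ObliqueRBMWedge.lean`). For test data `D : OrbmTestData M'` (a bounded measurable `F` with
uniform second-order Taylor data on the level region `{x, y ≥ 0, x + y ≤ M'}`, harmonic there and
satisfying the oblique boundary conditions in Lipschitz form; `ObliqueRBMWedgeDynkin.lean`) and
`M + 8a ≤ M'`, `a > 0`, we prove the **stopped Dynkin identity**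

  `E[ F(Z_{τ_M ∧ t}) ] = F(0)` for every `t ≥ 0`
  (`integral_stoppedProcess_canORBM_eq`),

where `Z = canORBM` is the canonical reflected process (`ObliqueRBMWedgeCanonical.lean`) and
`τ_M = canHit M` the hitting time of the level `M`. Proof: discretise `[0, t]` with mesh
`h = t/n`; the value `V_n` of `F(Z)` at the first grid time `≥ τ_M ∧ t` satisfies the
telescoping identity `V_n − F(Z_0) = Σ_{k<n} 𝟙{t_k < τ_M} (F(Z_{t_{k+1}}) − F(Z_{t_k}))`
(`discreteStopped_sub_eq_sum`); each term has expectation `E[𝟙{t_k < τ_M} G_h(Z_{t_k})]`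
(one-step identity `integral_indicator_mul_sub_eq`) and `|G_h(z)|` is bounded by
`abs_oneStep_le`; the bounds are summed over the grid using the occupation estimates
`measure_quadY_canORBM_lt_le` / `measure_quadX_canORBM_lt_le` (Tonelli:
`sum_integral_nearSides_le`) and the second-moment tails of the running supremum, giving
`|E V_n − F(0)| → 0` (`tendsto_integral_discreteStopped`); finally `V_n → F(Z_{τ_M ∧ t})` pointwise
(continuity of the paths; `F` is continuous on the level region) and boundedly, so
`E V_n → E F(Z_{τ_M ∧ t})`.

## References

* J.-F. Le Gall, *Brownian Motion, Martingales, and Stochastic Calculus* (2016), Ch. 6 (Thm. 6.14,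
  generator and martingales); W. Werner, LNM 1840 (2004), Ch. 5 §5.1. [WernerStFlour2004]
-/

noncomputable section

open MeasureTheory ProbabilityTheory Complex Set Filter Finset
open scoped NNReal Real Topology ENNReal BigOperators

namespace Literature.Probability.RandomPlanarGeometry

open Literature.Probability.Process

/-! ### The `z`-independent terms of the one-step bound -/

/-- Tail of the step size on the pair space: `P(a' < stepSup h) ≤ 2 · (512/9) · 16 h²/a'⁴` for
`a' ≥ 8√h`. [folklore] -/
theorem measure_lt_stepSup_le (h : ℝ≥0) {a' : ℝ} (ha : 8 * Real.sqrt h ≤ a') (ha0 : 0 < a') :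
    wienerPair {ω' | a' < stepSup h ω'} ≤ ENNReal.ofReal (2 * (512 / 9 * 16) * (h : ℝ) ^ 2 / a' ^ 4) := by
  haveI := isProbabilityMeasure_preWienerMeasure'
  set A : Set (ℝ≥0 → ℝ) := {ω₁ | a' / 2 < runSup h ω₁} with hA
  have hsub : {ω' : WienerPair | a' < stepSup h ω'} ⊆ (A ×ˢ univ) ∪ (univ ×ˢ A) := by
    intro ω' hω'
    simp only [mem_setOf_eq, stepSup] at hω'
    by_cases h1 : a' / 2 < runSup h ω'.1
    · exact Or.inl ⟨h1, mem_univ _⟩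
    · right
      refine ⟨mem_univ _, ?_⟩
      show a' / 2 < runSup h ω'.2
      linarith [not_lt.1 h1]
  have hb : preWienerMeasure A ≤ ENNReal.ofReal (512 / 9 * (h : ℝ) ^ 2 / (a' / 2) ^ 4) :=
    measure_lt_runSup_le h (by linarith) (by linarith)
  calc wienerPair {ω' | a' < stepSup h ω'} ≤ wienerPair ((A ×ˢ univ) ∪ (univ ×ˢ A)) := measure_mono hsub
    _ ≤ wienerPair (A ×ˢ univ) + wienerPair (univ ×ˢ A) := measure_union_le _ _
    _ = preWienerMeasure A + preWienerMeasure A := by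
        rw [wienerPair, Measure.prod_prod, Measure.prod_prod, measure_univ, mul_one, one_mul]
    _ ≤ ENNReal.ofReal (512 / 9 * (h : ℝ) ^ 2 / (a' / 2) ^ 4) +
          ENNReal.ofReal (512 / 9 * (h : ℝ) ^ 2 / (a' / 2) ^ 4) := add_le_add hb hb
    _ = ENNReal.ofReal (2 * (512 / 9 * 16) * (h : ℝ) ^ 2 / a' ^ 4) := by
        rw [← ENNReal.ofReal_add (by positivity) (by positivity)]
        congr 1
        field_simp
        ring

/-- **Second-moment tail of the step size**: for `m ≥ 8√h`, `m > 0`,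
`∫ stepSup² 𝟙{m < stepSup} ≤ (16/3) · (2·(512/9)·16) h²/m²`. [folklore] -/
theorem integral_stepSup_sq_indicator_le (h : ℝ≥0) {m : ℝ} (hm : 8 * Real.sqrt h ≤ m) (hm0 : 0 < m) :
    ∫ ω', stepSup h ω' ^ 2 * {ω' | m < stepSup h ω'}.indicator 1 ω' ∂wienerPair ≤
      16 / 3 * (2 * (512 / 9 * 16) * (h : ℝ) ^ 2) / m ^ 2 := by
  have hnn : 0 ≤ᵐ[wienerPair] fun ω' ↦ stepSup h ω' ^ 2 * {ω' | m < stepSup h ω'}.indicator (1 : WienerPair → ℝ) ω' :=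
    ae_of_all _ fun ω' ↦ mul_nonneg (sq_nonneg _) (indicator_one_nonneg _ _)
  have hmeas : AEMeasurable (fun ω' ↦ stepSup h ω' ^ 2 * {ω' | m < stepSup h ω'}.indicator (1 : WienerPair → ℝ) ω')
      wienerPair :=
    (((measurable_stepSup h).pow_const 2).mul ((measurable_indicator_const_iff 1).2
      (measurableSet_lt measurable_const (measurable_stepSup h)))).aemeasurable
  rw [integral_eq_lintegral_of_nonneg_ae hnn hmeas.aestronglyMeasurable]
  have hlin := lintegral_sq_indicator_le_of_tail (μ := wienerPair) (measurable_stepSup h) (stepSup_nonneg h)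
    hm0 (by positivity : (0:ℝ) ≤ 2 * (512 / 9 * 16) * (h : ℝ) ^ 2)
    (fun a' ha' ↦ measure_lt_stepSup_le h (hm.trans ha') (hm0.trans_le ha'))
  refine (ENNReal.toReal_mono ENNReal.ofReal_ne_top hlin).trans ?_
  rw [ENNReal.toReal_ofReal (by positivity)]

/-- **The bad event is `O(h²)`**: `P((goodEvent (a/2) h)ᶜ) ≤ 256 h²/a⁴` for `h ≤ a²/8`, `a > 0`.
[folklore] -/
theorem measureReal_compl_goodEvent_le {a : ℝ} (ha : 0 < a) (h : ℝ≥0) (hh : (h : ℝ) ≤ a ^ 2 / 8) :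
    wienerPair.real (goodEvent (a / 2) h)ᶜ ≤ 256 * (h : ℝ) ^ 2 / a ^ 4 := by
  haveI := isProbabilityMeasure_preWienerMeasure'
  have hlt : (h : ℝ) < (a / 2) ^ 2 := by nlinarith
  have hb := measure_compl_goodEvent_le (by positivity : 0 ≤ a / 2) h hlt
  have hden : (a / 2) ^ 2 / 2 ≤ (a / 2) ^ 2 - h := by nlinarith
  have hden0 : 0 < (a / 2) ^ 2 / 2 := by positivity
  have hreal : 2 * (2 * (h : ℝ) ^ 2 / ((a / 2) ^ 2 - h) ^ 2) ≤ 256 * (h : ℝ) ^ 2 / a ^ 4 := by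
    calc 2 * (2 * (h : ℝ) ^ 2 / ((a / 2) ^ 2 - h) ^ 2) ≤ 2 * (2 * (h : ℝ) ^ 2 / ((a / 2) ^ 2 / 2) ^ 2) := by
          gcongr
      _ = 256 * (h : ℝ) ^ 2 / a ^ 4 := by field_simp; ring
  rw [measureReal_def]
  refine (ENNReal.toReal_mono (by finiteness) hb).trans ?_
  rw [ENNReal.toReal_mul, ENNReal.toReal_ofReal (by positivity)]
  simpa using hreal

namespace OrbmTestData

variable {M' : ℝ} (D : OrbmTestData M')

/-- Split of the modulus term: `∫ ω(5S) S² ≤ ω(5m) ∫ S² + ω̄ ∫ S² 𝟙{m < S}`. [folklore] -/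
theorem integral_ω_stepSup_le (h : ℝ≥0) (m : ℝ) :
    ∫ ω', D.ω (5 * stepSup h ω') * stepSup h ω' ^ 2 ∂wienerPair ≤
      D.ω (5 * m) * ∫ ω', stepSup h ω' ^ 2 ∂wienerPair +
        D.ωbar * ∫ ω', stepSup h ω' ^ 2 * {ω' | m < stepSup h ω'}.indicator 1 ω' ∂wienerPair := by
  have hS2 := integrable_stepSup_sq h
  have hmS := measurable_stepSup h
  have i2 : Integrable (fun ω' ↦ D.ω (5 * stepSup h ω') * stepSup h ω' ^ 2) wienerPair := by
    refine ((hS2.const_mul D.ωbar).mono' ((D.measurable_ω_stepSup h).mul (hmS.pow_const 2)).aestronglyMeasurable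
      (ae_of_all _ fun ω' ↦ ?_))
    rw [Real.norm_eq_abs, abs_mul, abs_of_nonneg (D.ω_nonneg _), abs_of_nonneg (sq_nonneg (stepSup h ω'))]
    nlinarith [D.ω_le (5 * stepSup h ω'), sq_nonneg (stepSup h ω')]
  have i4 : Integrable (fun ω' ↦ stepSup h ω' ^ 2 * {ω' | m < stepSup h ω'}.indicator (1 : WienerPair → ℝ) ω')
      wienerPair := by
    refine (hS2.mono' ((hmS.pow_const 2).mul ((measurable_indicator_const_iff 1).2
        (measurableSet_lt measurable_const hmS))).aestronglyMeasurable (ae_of_all _ fun ω' ↦ ?_))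
    rw [Real.norm_eq_abs, abs_mul, abs_of_nonneg (sq_nonneg (stepSup h ω'))]
    have := abs_indicator_one_le {ω' | m < stepSup h ω'} ω'
    nlinarith [sq_nonneg (stepSup h ω'), abs_nonneg ({ω' | m < stepSup h ω'}.indicator (1 : WienerPair → ℝ) ω')]
  rw [← integral_const_mul, ← integral_const_mul, ← integral_add (hS2.const_mul _) (i4.const_mul _)]
  refine integral_mono i2 ((hS2.const_mul _).add (i4.const_mul _)) fun ω' ↦ ?_
  simp only
  by_cases hc : m < stepSup h ω'
  · rw [indicator_of_mem (by exact hc), Pi.one_apply, mul_one]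
    have h1 := D.ω_le (5 * stepSup h ω')
    have h2 := D.ω_nonneg (5 * m)
    nlinarith [sq_nonneg (stepSup h ω')]
  · rw [indicator_of_notMem (by exact hc), mul_zero, mul_zero, add_zero]
    have h1 : D.ω (5 * stepSup h ω') ≤ D.ω (5 * m) := D.ω_mono (by linarith [not_lt.1 hc])
    nlinarith [sq_nonneg (stepSup h ω')]

/-! ### The `z`-dependent term, summed over the grid (Tonelli and the occupation estimate) -/

/-- The near-side indicator is jointly measurable in `(z, ω')`. [folklore] -/
theorem measurable_nearSides_uncurry (h : ℝ≥0) :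
    Measurable fun p : ℂ × WienerPair ↦ nearSides p.1 h p.2 := by
  unfold nearSides
  have hS : Measurable fun p : ℂ × WienerPair ↦ 2 * stepSup h p.2 :=
    ((measurable_stepSup h).comp measurable_snd).const_mul 2
  have hy : Measurable fun p : ℂ × WienerPair ↦ quadY p.1 := measurable_quadY.comp measurable_fst
  have hx : Measurable fun p : ℂ × WienerPair ↦ quadX p.1 := measurable_quadX.comp measurable_fst
  have m1 : Measurable fun p : ℂ × WienerPair ↦ {ω' | quadY p.1 < 2 * stepSup h ω'}.indicator (1 : WienerPair → ℝ) p.2 := by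
    have : (fun p : ℂ × WienerPair ↦ {ω' | quadY p.1 < 2 * stepSup h ω'}.indicator (1 : WienerPair → ℝ) p.2) =
        {p : ℂ × WienerPair | quadY p.1 < 2 * stepSup h p.2}.indicator 1 := by
      funext p
      by_cases hp : quadY p.1 < 2 * stepSup h p.2
      · rw [indicator_of_mem (by exact hp), indicator_of_mem (by exact hp)]; rfl
      · rw [indicator_of_notMem (by exact hp), indicator_of_notMem (by exact hp)]
    rw [this]
    exact (measurable_indicator_const_iff 1).2 (measurableSet_lt hy hS)
  have m2 : Measurable fun p : ℂ × WienerPair ↦ {ω' | quadX p.1 < 2 * stepSup h ω'}.indicator (1 : WienerPair → ℝ) p.2 := by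
    have : (fun p : ℂ × WienerPair ↦ {ω' | quadX p.1 < 2 * stepSup h ω'}.indicator (1 : WienerPair → ℝ) p.2) =
        {p : ℂ × WienerPair | quadX p.1 < 2 * stepSup h p.2}.indicator 1 := by
      funext p
      by_cases hp : quadX p.1 < 2 * stepSup h p.2
      · rw [indicator_of_mem (by exact hp), indicator_of_mem (by exact hp)]; rfl
      · rw [indicator_of_notMem (by exact hp), indicator_of_notMem (by exact hp)]
    rw [this]
    exact (measurable_indicator_const_iff 1).2 (measurableSet_lt hx hS)
  exact m1.add m2

/-- The `z`-dependent integral `I_h(z) = ∫ S² J_z` is measurable in `z` and bounded by `2 ∫ S²`.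
[folklore] -/
theorem measurable_integral_nearSides (h : ℝ≥0) :
    Measurable fun z : ℂ ↦ ∫ ω', stepSup h ω' ^ 2 * nearSides z h ω' ∂wienerPair := by
  have hm : Measurable fun p : ℂ × WienerPair ↦ stepSup h p.2 ^ 2 * nearSides p.1 h p.2 :=
    (((measurable_stepSup h).comp measurable_snd).pow_const 2).mul (measurable_nearSides_uncurry h)
  exact (hm.stronglyMeasurable.integral_prod_right' (ν := wienerPair)).measurable

/-- Auxiliary statement (`integral_nearSides_le`). [folklore] -/
theorem integral_nearSides_le (h : ℝ≥0) (z : ℂ) :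
    ∫ ω', stepSup h ω' ^ 2 * nearSides z h ω' ∂wienerPair ≤ 2 * ∫ ω', stepSup h ω' ^ 2 ∂wienerPair := by
  have hS2 := integrable_stepSup_sq h
  rw [← integral_const_mul]
  refine integral_mono_of_nonneg (ae_of_all _ fun ω' ↦ mul_nonneg (sq_nonneg _) (nearSides_nonneg z h ω'))
    (hS2.const_mul 2) (ae_of_all _ fun ω' ↦ ?_)
  simp only
  nlinarith [nearSides_le_two z h ω', sq_nonneg (stepSup h ω')]

/-- Auxiliary statement (`integral_nearSides_nonneg`). [folklore] -/
theorem integral_nearSides_nonneg (h : ℝ≥0) (z : ℂ) :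
    0 ≤ ∫ ω', stepSup h ω' ^ 2 * nearSides z h ω' ∂wienerPair :=
  integral_nonneg fun ω' ↦ mul_nonneg (sq_nonneg _) (nearSides_nonneg z h ω')

/-- **Tonelli for the `z`-dependent term along the process**: for any time `s`,
`E_ω[ ∫ S'² J_{Z_s ω} dω' ] = ∫ S'(ω')² (P(y(Z_s) < 2S'(ω')) + P(x(Z_s) < 2S'(ω'))) dω'`. [folklore] -/
theorem integral_integral_nearSides_canORBM (h s : ℝ≥0) :
    ∫ ω, ∫ ω', stepSup h ω' ^ 2 * nearSides (canORBM s ω) h ω' ∂wienerPair ∂wienerPair =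
      ∫ ω', stepSup h ω' ^ 2 * (wienerPair.real {ω | quadY (canORBM s ω) < 2 * stepSup h ω'} +
        wienerPair.real {ω | quadX (canORBM s ω) < 2 * stepSup h ω'}) ∂wienerPair := by
  haveI := isProbabilityMeasure_preWienerMeasure'
  -- the integrand on the product
  set f : WienerPair → WienerPair → ℝ := fun ω ω' ↦ stepSup h ω' ^ 2 * nearSides (canORBM s ω) h ω' with hf
  have hfm : Measurable (Function.uncurry f) := by
    have h1 : Measurable fun p : WienerPair × WienerPair ↦ stepSup h p.2 ^ 2 :=
      ((measurable_stepSup h).comp measurable_snd).pow_const 2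
    have h2 : Measurable fun p : WienerPair × WienerPair ↦ nearSides (canORBM s p.1) h p.2 :=
      (measurable_nearSides_uncurry h).comp (((measurable_canORBM s).comp measurable_fst).prodMk measurable_snd)
    exact h1.mul h2
  have hS2 := integrable_stepSup_sq h
  have hint : Integrable (Function.uncurry f) (wienerPair.prod wienerPair) := by
    -- dominated by `2 S'(ω')²`, integrable on the product
    have hdom : Integrable (fun p : WienerPair × WienerPair ↦ 2 * stepSup h p.2 ^ 2) (wienerPair.prod wienerPair) := by
      have := (hS2.const_mul 2).comp_snd (μ := wienerPair)  -- may not exist; fallback below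
      exact this
    refine hdom.mono' hfm.aestronglyMeasurable (ae_of_all _ fun p ↦ ?_)
    simp only [Function.uncurry, hf, Real.norm_eq_abs, abs_mul, abs_of_nonneg (sq_nonneg (stepSup h p.2)),
      abs_of_nonneg (nearSides_nonneg (canORBM s p.1) h p.2)]
    nlinarith [nearSides_le_two (canORBM s p.1) h p.2, sq_nonneg (stepSup h p.2)]
  rw [integral_integral_swap hint]
  refine integral_congr_ae (ae_of_all _ fun ω' ↦ ?_)
  simp only [hf]
  rw [integral_const_mul]
  congr 1
  unfold nearSides
  have e1 : (fun a : WienerPair ↦ {ω'' | quadY (canORBM s a) < 2 * stepSup h ω''}.indicator (1 : WienerPair → ℝ) ω') =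
      {a : WienerPair | quadY (canORBM s a) < 2 * stepSup h ω'}.indicator 1 := by
    funext a; simp only [indicator_apply, mem_setOf_eq, Pi.one_apply]
  have e2 : (fun a : WienerPair ↦ {ω'' | quadX (canORBM s a) < 2 * stepSup h ω''}.indicator (1 : WienerPair → ℝ) ω') =
      {a : WienerPair | quadX (canORBM s a) < 2 * stepSup h ω'}.indicator 1 := by
    funext a; simp only [indicator_apply, mem_setOf_eq, Pi.one_apply]
  have m1 : MeasurableSet {a : WienerPair | quadY (canORBM s a) < 2 * stepSup h ω'} :=
    measurableSet_lt (measurable_quadY.comp (measurable_canORBM s)) measurable_const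
  have m2 : MeasurableSet {a : WienerPair | quadX (canORBM s a) < 2 * stepSup h ω'} :=
    measurableSet_lt (measurable_quadX.comp (measurable_canORBM s)) measurable_const
  have i1 : Integrable (fun a : WienerPair ↦ {ω'' | quadY (canORBM s a) < 2 * stepSup h ω''}.indicator
      (1 : WienerPair → ℝ) ω') wienerPair := by rw [e1]; exact (integrable_const (1:ℝ)).indicator m1
  have i2 : Integrable (fun a : WienerPair ↦ {ω'' | quadX (canORBM s a) < 2 * stepSup h ω''}.indicator
      (1 : WienerPair → ℝ) ω') wienerPair := by rw [e2]; exact (integrable_const (1:ℝ)).indicator m2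
  rw [integral_add i1 i2, e1, e2, integral_indicator_one m1, integral_indicator_one m2]

end OrbmTestData

/-! ### Continuity of the test function on the level region -/

namespace OrbmTestData

variable {M' : ℝ} (D : OrbmTestData M')

/-- **Modulus of continuity of `F` on the level region** (from the Taylor data):
`|F z' − F z| ≤ 2C₁ ‖z'−z‖ + (2C₁ + ω̄) ‖z'−z‖²`. [folklore] -/
theorem abs_sub_le {z z' : ℂ} (hz : z ∈ levelRegion M') (hz' : z' ∈ levelRegion M') :
    |D.F z' - D.F z| ≤ 2 * D.C₁ * ‖z' - z‖ + (2 * D.C₁ + D.ωbar) * ‖z' - z‖ ^ 2 := by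
  have hT := D.taylor z hz z' hz'
  set Δ := z' - z with hΔ
  have hre : |Δ.re| ≤ ‖Δ‖ := Complex.abs_re_le_norm Δ
  have him : |Δ.im| ≤ ‖Δ‖ := Complex.abs_im_le_norm Δ
  have c1 := D.abs_f₁_le z hz; have c2 := D.abs_f₂_le z hz
  have c11 := D.abs_f₁₁_le z hz; have c12 := D.abs_f₁₂_le z hz; have c22 := D.abs_f₂₂_le z hz
  have hC₁ := D.C₁_nonneg
  have hn := norm_nonneg Δ
  have hlin : |D.f₁ z * Δ.re + D.f₂ z * Δ.im| ≤ 2 * D.C₁ * ‖Δ‖ := by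
    calc |D.f₁ z * Δ.re + D.f₂ z * Δ.im| ≤ |D.f₁ z * Δ.re| + |D.f₂ z * Δ.im| := abs_add_le _ _
      _ = |D.f₁ z| * |Δ.re| + |D.f₂ z| * |Δ.im| := by rw [abs_mul, abs_mul]
      _ ≤ D.C₁ * ‖Δ‖ + D.C₁ * ‖Δ‖ := by gcongr
      _ = 2 * D.C₁ * ‖Δ‖ := by ring
  have hquad : |(D.f₁₁ z * Δ.re ^ 2 + 2 * D.f₁₂ z * Δ.re * Δ.im + D.f₂₂ z * Δ.im ^ 2) / 2| ≤
      2 * D.C₁ * ‖Δ‖ ^ 2 := by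
    have hpq : |Δ.re * Δ.im| ≤ ‖Δ‖ ^ 2 := by rw [abs_mul]; nlinarith [abs_nonneg Δ.re, abs_nonneg Δ.im]
    have hp2 : Δ.re ^ 2 ≤ ‖Δ‖ ^ 2 := by nlinarith [abs_nonneg Δ.re, sq_abs Δ.re]
    have hq2 : Δ.im ^ 2 ≤ ‖Δ‖ ^ 2 := by nlinarith [abs_nonneg Δ.im, sq_abs Δ.im]
    rw [abs_div, abs_two]
    calc |D.f₁₁ z * Δ.re ^ 2 + 2 * D.f₁₂ z * Δ.re * Δ.im + D.f₂₂ z * Δ.im ^ 2| / 2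
        ≤ (|D.f₁₁ z * Δ.re ^ 2| + |2 * D.f₁₂ z * Δ.re * Δ.im| + |D.f₂₂ z * Δ.im ^ 2|) / 2 := by
          gcongr; exact abs_add_three _ _ _
      _ = (|D.f₁₁ z| * Δ.re ^ 2 + 2 * |D.f₁₂ z| * |Δ.re * Δ.im| + |D.f₂₂ z| * Δ.im ^ 2) / 2 := by
          rw [abs_mul, abs_of_nonneg (sq_nonneg Δ.re), abs_mul (D.f₂₂ z), abs_of_nonneg (sq_nonneg Δ.im),
            show 2 * D.f₁₂ z * Δ.re * Δ.im = 2 * (D.f₁₂ z * (Δ.re * Δ.im)) by ring, abs_mul, abs_two, abs_mul]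
          ring
      _ ≤ (D.C₁ * ‖Δ‖ ^ 2 + 2 * D.C₁ * ‖Δ‖ ^ 2 + D.C₁ * ‖Δ‖ ^ 2) / 2 := by gcongr
      _ = 2 * D.C₁ * ‖Δ‖ ^ 2 := by ring
  have hrem : D.ω ‖Δ‖ * ‖Δ‖ ^ 2 ≤ D.ωbar * ‖Δ‖ ^ 2 :=
    mul_le_mul_of_nonneg_right (D.ω_le _) (sq_nonneg _)
  have key : |D.F z' - D.F z| ≤
      |D.F z' - D.F z - (D.f₁ z * Δ.re + D.f₂ z * Δ.im)
        - (D.f₁₁ z * Δ.re ^ 2 + 2 * D.f₁₂ z * Δ.re * Δ.im + D.f₂₂ z * Δ.im ^ 2) / 2|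
      + |D.f₁ z * Δ.re + D.f₂ z * Δ.im|
      + |(D.f₁₁ z * Δ.re ^ 2 + 2 * D.f₁₂ z * Δ.re * Δ.im + D.f₂₂ z * Δ.im ^ 2) / 2| := by
    have := abs_add_three
      (D.F z' - D.F z - (D.f₁ z * Δ.re + D.f₂ z * Δ.im)
        - (D.f₁₁ z * Δ.re ^ 2 + 2 * D.f₁₂ z * Δ.re * Δ.im + D.f₂₂ z * Δ.im ^ 2) / 2)
      (D.f₁ z * Δ.re + D.f₂ z * Δ.im)
      ((D.f₁₁ z * Δ.re ^ 2 + 2 * D.f₁₂ z * Δ.re * Δ.im + D.f₂₂ z * Δ.im ^ 2) / 2)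
    have e : D.F z' - D.F z - (D.f₁ z * Δ.re + D.f₂ z * Δ.im)
        - (D.f₁₁ z * Δ.re ^ 2 + 2 * D.f₁₂ z * Δ.re * Δ.im + D.f₂₂ z * Δ.im ^ 2) / 2
        + (D.f₁ z * Δ.re + D.f₂ z * Δ.im)
        + (D.f₁₁ z * Δ.re ^ 2 + 2 * D.f₁₂ z * Δ.re * Δ.im + D.f₂₂ z * Δ.im ^ 2) / 2 = D.F z' - D.F z := by ring
    rw [e] at this
    exact this
  linarith [key, hT, hlin, hquad, hrem]

/-! ### The grid, the first stopped index and the discretely stopped value -/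

/-- The mesh `h = t/n` (`0` for `n = 0`). [folklore] -/
def mesh (t : ℝ≥0) (n : ℕ) : ℝ≥0 := t / n

/-- The grid points `t_k = k h`. [folklore] -/
def grid (t : ℝ≥0) (n k : ℕ) : ℝ≥0 := (k : ℝ≥0) * mesh t n

/-- Auxiliary statement (`grid_zero`). [folklore] -/
theorem grid_zero (t : ℝ≥0) (n : ℕ) : grid t n 0 = 0 := by simp [grid]

/-- Auxiliary statement (`grid_succ`). [folklore] -/
theorem grid_succ (t : ℝ≥0) (n k : ℕ) : grid t n (k + 1) = grid t n k + mesh t n := by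
  simp [grid]; ring

/-- Auxiliary statement (`grid_self`). [folklore] -/
theorem grid_self {t : ℝ≥0} {n : ℕ} (hn : n ≠ 0) : grid t n n = t := by
  simp [grid, mesh]
  rw [mul_div_cancel₀ _ (by exact_mod_cast hn)]

/-- Auxiliary statement (`grid_mono`). [folklore] -/
theorem grid_mono (t : ℝ≥0) (n : ℕ) {j k : ℕ} (h : j ≤ k) : grid t n j ≤ grid t n k := by
  unfold grid; gcongr

/-- Auxiliary statement (`grid_le`). [folklore] -/
theorem grid_le {t : ℝ≥0} {n k : ℕ} (hn : n ≠ 0) (hk : k ≤ n) : grid t n k ≤ t :=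
  (grid_mono t n hk).trans_eq (grid_self hn)

/-- Auxiliary statement (`coe_mesh`). [folklore] -/
theorem coe_mesh (t : ℝ≥0) (n : ℕ) : (mesh t n : ℝ) = t / n := by
  simp [mesh]

/-- **The first stopped index** `κ = min {k | τ_M ≤ t_k ∨ n ≤ k}` (`≤ n`). [folklore] -/
def firstIdx (M : ℝ) (t : ℝ≥0) (n : ℕ) (ω : WienerPair) : ℕ := by
  classical
  exact Nat.find (⟨n, Or.inr le_rfl⟩ : ∃ k : ℕ, canHit M ω ≤ (grid t n k : WithTop ℝ≥0) ∨ n ≤ k)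

/-- Auxiliary statement (`firstIdx_spec`). [folklore] -/
theorem firstIdx_spec (M : ℝ) (t : ℝ≥0) (n : ℕ) (ω : WienerPair) :
    canHit M ω ≤ (grid t n (firstIdx M t n ω) : WithTop ℝ≥0) ∨ n ≤ firstIdx M t n ω := by
  classical
  exact Nat.find_spec (⟨n, Or.inr le_rfl⟩ : ∃ k : ℕ, canHit M ω ≤ (grid t n k : WithTop ℝ≥0) ∨ n ≤ k)

/-- Auxiliary statement (`firstIdx_le`). [folklore] -/
theorem firstIdx_le (M : ℝ) (t : ℝ≥0) (n : ℕ) (ω : WienerPair) : firstIdx M t n ω ≤ n := by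
  classical
  exact Nat.find_min' _ (Or.inr le_rfl)

/-- Auxiliary statement (`coe_lt_canHit_of_lt_firstIdx`). [folklore] -/
theorem coe_lt_canHit_of_lt_firstIdx {M : ℝ} {t : ℝ≥0} {n k : ℕ} {ω : WienerPair}
    (hk : k < firstIdx M t n ω) : (grid t n k : WithTop ℝ≥0) < canHit M ω ∧ k < n := by
  classical
  have := Nat.find_min (⟨n, Or.inr le_rfl⟩ : ∃ k : ℕ, canHit M ω ≤ (grid t n k : WithTop ℝ≥0) ∨ n ≤ k) hk
  rw [not_or, not_le, not_le] at this
  exact this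

/-- Auxiliary statement (`not_coe_lt_canHit_of_firstIdx_le`). [folklore] -/
theorem not_coe_lt_canHit_of_firstIdx_le {M : ℝ} {t : ℝ≥0} {n k : ℕ} {ω : WienerPair}
    (hk : firstIdx M t n ω ≤ k) (hkn : k < n) : ¬ (grid t n k : WithTop ℝ≥0) < canHit M ω := by
  rcases firstIdx_spec M t n ω with h | h
  · exact not_lt.2 (h.trans (WithTop.coe_le_coe.2 (grid_mono t n hk)))
  · exact absurd (hk.trans_lt hkn) (not_lt.2 h)

/-- **The discretely stopped value** `V_n = F(Z_{t_κ})`. [folklore] -/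
def discreteStopped (M : ℝ) (t : ℝ≥0) (n : ℕ) (ω : WienerPair) : ℝ :=
  D.F (canORBM (grid t n (firstIdx M t n ω)) ω)

/-- **Telescoping identity**: `V_n − F(Z_0) = Σ_{k<n} 𝟙{t_k < τ_M} (F(Z_{t_{k+1}}) − F(Z_{t_k}))`.
[folklore] -/
theorem discreteStopped_sub_eq_sum (M : ℝ) (t : ℝ≥0) (n : ℕ) (ω : WienerPair) :
    D.discreteStopped M t n ω - D.F (canORBM 0 ω) =
      ∑ k ∈ Finset.range n, {ω | (grid t n k : WithTop ℝ≥0) < canHit M ω}.indicator 1 ω *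
        (D.F (canORBM (grid t n (k + 1)) ω) - D.F (canORBM (grid t n k) ω)) := by
  set κ := firstIdx M t n ω with hκ
  have hκn : κ ≤ n := firstIdx_le M t n ω
  rw [← Finset.sum_range_add_sum_Ico _ hκn]
  have h1 : ∑ k ∈ Finset.range κ, {ω | (grid t n k : WithTop ℝ≥0) < canHit M ω}.indicator (1 : WienerPair → ℝ) ω *
      (D.F (canORBM (grid t n (k + 1)) ω) - D.F (canORBM (grid t n k) ω)) =
      ∑ k ∈ Finset.range κ, (D.F (canORBM (grid t n (k + 1)) ω) - D.F (canORBM (grid t n k) ω)) := by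
    refine Finset.sum_congr rfl fun k hk ↦ ?_
    rw [Finset.mem_range] at hk
    rw [indicator_of_mem (by exact (coe_lt_canHit_of_lt_firstIdx hk).1), Pi.one_apply, one_mul]
  have h2 : ∑ k ∈ Finset.Ico κ n, {ω | (grid t n k : WithTop ℝ≥0) < canHit M ω}.indicator (1 : WienerPair → ℝ) ω *
      (D.F (canORBM (grid t n (k + 1)) ω) - D.F (canORBM (grid t n k) ω)) = 0 := by
    refine Finset.sum_eq_zero fun k hk ↦ ?_
    rw [Finset.mem_Ico] at hk
    rw [indicator_of_notMem (by exact not_coe_lt_canHit_of_firstIdx_le hk.1 hk.2), zero_mul]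
  rw [h1, h2, add_zero, Finset.sum_range_sub (fun k ↦ D.F (canORBM (grid t n k) ω)), grid_zero,
    discreteStopped]

/-- Measurability of the discretely stopped value (through the telescoping identity). [folklore] -/
theorem measurable_discreteStopped (M : ℝ) (t : ℝ≥0) (n : ℕ) : Measurable (D.discreteStopped M t n) := by
  have : D.discreteStopped M t n = fun ω ↦ D.F (canORBM 0 ω) +
      ∑ k ∈ Finset.range n, {ω | (grid t n k : WithTop ℝ≥0) < canHit M ω}.indicator 1 ω *
        (D.F (canORBM (grid t n (k + 1)) ω) - D.F (canORBM (grid t n k) ω)) := by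
    funext ω; rw [← D.discreteStopped_sub_eq_sum]; ring
  rw [this]
  refine (D.measurableF.comp (measurable_canORBM 0)).add (Finset.measurable_sum _ fun k _ ↦ ?_)
  exact ((measurable_indicator_const_iff 1).2 (measurableSet_coe_lt_canHit _ M)).mul
    ((D.measurableF.comp (measurable_canORBM _)).sub (D.measurableF.comp (measurable_canORBM _)))

/-! ### Convergence of the discretely stopped value -/

/-- The stopped time `σ = t ∧ τ_M` read in `ℝ≥0`. [folklore] -/
def stopTime (M : ℝ) (t : ℝ≥0) (ω : WienerPair) : ℝ≥0 := (min (t : WithTop ℝ≥0) (canHit M ω)).untopA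

/-- Auxiliary statement (`stopTime_le`). [folklore] -/
theorem stopTime_le (M : ℝ) (t : ℝ≥0) (ω : WienerPair) : stopTime M t ω ≤ t := untopA_min_coe_le t _

/-- Auxiliary statement (`stoppedProcess_canORBM_eq`). [folklore] -/
theorem stoppedProcess_canORBM_eq (M : ℝ) (t : ℝ≥0) (ω : WienerPair) :
    stoppedProcess canORBM (canHit M) t ω = canORBM (stopTime M t ω) ω := rfl

/-- **The grid time `t_κ` is within one mesh of `t ∧ τ_M`**: `t ∧ τ ≤ t_κ ≤ t ∧ τ + h` (`n ≠ 0`).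
[folklore] -/
theorem stopTime_le_grid_firstIdx {M : ℝ} {t : ℝ≥0} {n : ℕ} (hn : n ≠ 0) (ω : WienerPair) :
    stopTime M t ω ≤ grid t n (firstIdx M t n ω) ∧
      (grid t n (firstIdx M t n ω) : ℝ) ≤ stopTime M t ω + mesh t n := by
  set κ := firstIdx M t n ω with hκ
  have hκn : κ ≤ n := firstIdx_le M t n ω
  have hgt : grid t n κ ≤ t := grid_le hn hκn
  rcases firstIdx_spec M t n ω with h | h
  · -- `τ ≤ t_κ`: then `τ = T` finite, `σ = T ≤ t_κ` and `t_{κ-1} < T`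
    obtain ⟨T, hT⟩ := WithTop.ne_top_iff_exists.1 (ne_top_of_le_ne_top WithTop.coe_ne_top h)
    have hTκ : T ≤ grid t n κ := by rw [← hT] at h; exact WithTop.coe_le_coe.1 h
    have hσ : stopTime M t ω = T := by
      rw [stopTime, ← hT, untopA_min_coe_coe, min_eq_right (hTκ.trans hgt)]
    refine ⟨by rw [hσ]; exact hTκ, ?_⟩
    rw [hσ]
    rcases Nat.eq_zero_or_pos κ with h0 | hpos
    · rw [h0, grid_zero]; push_cast; linarith [T.coe_nonneg, (mesh t n).coe_nonneg]
    · have hprev := (coe_lt_canHit_of_lt_firstIdx (Nat.sub_one_lt_of_lt hpos : κ - 1 < κ)).1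
      rw [← hT] at hprev
      have hlt : grid t n (κ - 1) < T := WithTop.coe_lt_coe.1 hprev
      have heq : grid t n κ = grid t n (κ - 1) + mesh t n := by
        rw [← grid_succ, Nat.sub_add_cancel hpos]
      rw [heq]; push_cast
      have : (grid t n (κ - 1) : ℝ) < T := by exact_mod_cast hlt
      linarith
  · -- `n ≤ κ`: then `κ = n`, `t_κ = t`, and `σ ≤ t`
    have hκeq : κ = n := le_antisymm hκn h
    rw [hκeq, grid_self hn]
    refine ⟨stopTime_le M t ω, ?_⟩
    -- `σ = t ∧ τ ≥ t - h`: `t_{n-1} < τ` unless `n - 1 < κ` fails… we use `t_{n-1} < τ` from minimality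
    have hpos : 0 < n := Nat.pos_of_ne_zero hn
    have hprev := (coe_lt_canHit_of_lt_firstIdx (by rw [← hκ, hκeq]; exact Nat.sub_one_lt_of_lt hpos :
      n - 1 < firstIdx M t n ω)).1
    have hgn : grid t n (n - 1) + mesh t n = grid t n n := by
      rw [← grid_succ, Nat.sub_add_cancel hpos]
    have heq : (t : ℝ) = grid t n (n - 1) + mesh t n := by
      have h1 : ((grid t n (n - 1) + mesh t n : ℝ≥0) : ℝ) = (grid t n n : ℝ) := by rw [hgn]
      push_cast at h1
      rw [grid_self hn] at h1
      linarith
    -- `σ ≥ min t τ ≥ t_{n-1}` since `τ > t_{n-1}` and `t > t_{n-1}`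
    have hσ : (grid t n (n - 1) : ℝ) ≤ stopTime M t ω := by
      rw [stopTime]
      induction hc : canHit M ω with
      | top => rw [untopA_min_coe_top]; exact_mod_cast grid_le hn (Nat.sub_le n 1)
      | coe T =>
        rw [untopA_min_coe_coe]; push_cast
        rw [hc] at hprev
        have h1 : (grid t n (n - 1) : ℝ) < T := by exact_mod_cast WithTop.coe_lt_coe.1 hprev
        have h2 : (grid t n (n - 1) : ℝ) ≤ t := by exact_mod_cast grid_le hn (Nat.sub_le n 1)
        exact le_min h2 h1.le
    linarith

/-- The stopped position lies in `levelRegion M` (`M > 0`). [folklore] -/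
theorem canORBM_stopTime_mem {M : ℝ} (hM : 0 < M) (t : ℝ≥0) (ω : WienerPair) :
    canORBM (stopTime M t ω) ω ∈ levelRegion M := by
  refine ⟨quadX_canORBM_nonneg _ ω, quadY_canORBM_nonneg _ ω, ?_⟩
  show canLevel (stopTime M t ω) ω ≤ M
  rw [stopTime]
  induction hc : canHit M ω with
  | top =>
    rw [untopA_min_coe_top]
    exact (canLevel_lt_of_coe_lt_canHit (by rw [hc]; exact WithTop.coe_lt_top t)).le
  | coe T =>
    rw [untopA_min_coe_coe]
    rcases le_total t T with h | h
    · rw [min_eq_left h]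
      rcases h.eq_or_lt with h' | h'
      · rw [h', canLevel_canHit hM hc]
      · exact (canLevel_lt_of_coe_lt_canHit (by rw [hc]; exact WithTop.coe_lt_coe.2 h')).le
    · rw [min_eq_right h, canLevel_canHit hM hc]

/-- On `{t_k < τ_M}` the position `Z_{t_k}` lies in `levelRegion M`. [folklore] -/
theorem canORBM_mem_levelRegion_of_coe_lt {M : ℝ} {s : ℝ≥0} {ω : WienerPair}
    (h : (s : WithTop ℝ≥0) < canHit M ω) : canORBM s ω ∈ levelRegion M :=
  ⟨quadX_canORBM_nonneg s ω, quadY_canORBM_nonneg s ω, (canLevel_lt_of_coe_lt_canHit h).le⟩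

/-- **Pointwise convergence** `V_n(ω) → F(Z_{t ∧ τ_M}(ω))` (`M + 8a ≤ M'`-type margin: `M < M'`,
`M > 0`). [folklore] -/
theorem tendsto_discreteStopped {M : ℝ} (hM : 0 < M) (hMM' : M < M') (t : ℝ≥0) (ω : WienerPair) :
    Tendsto (fun n ↦ D.discreteStopped M t n ω) atTop
      (𝓝 (D.F (stoppedProcess canORBM (canHit M) t ω))) := by
  rw [stoppedProcess_canORBM_eq]
  set σ := stopTime M t ω with hσ
  set z := canORBM σ ω with hz
  have hzM : z ∈ levelRegion M := canORBM_stopTime_mem hM t ω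
  have hzM' : z ∈ levelRegion M' := levelRegion_mono hMM'.le hzM
  -- the grid times converge to `σ`
  have hgrid : Tendsto (fun n ↦ grid t n (firstIdx M t n ω)) atTop (𝓝 σ) := by
    rw [← NNReal.tendsto_coe]
    have hmesh : Tendsto (fun n : ℕ ↦ (σ : ℝ) + mesh t n) atTop (𝓝 ((σ : ℝ) + 0)) := by
      refine tendsto_const_nhds.add ?_
      have : Tendsto (fun n : ℕ ↦ (t : ℝ) / n) atTop (𝓝 0) := tendsto_const_div_atTop_nhds_zero_nat _
      refine this.congr' ?_
      exact Eventually.of_forall fun n ↦ by simp only [coe_mesh]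
    rw [add_zero] at hmesh
    refine tendsto_of_tendsto_of_tendsto_of_le_of_le' tendsto_const_nhds hmesh ?_ ?_
    · filter_upwards [eventually_ne_atTop 0] with n hn
      exact_mod_cast (stopTime_le_grid_firstIdx hn ω).1
    · filter_upwards [eventually_ne_atTop 0] with n hn
      exact (stopTime_le_grid_firstIdx hn ω).2
  -- positions converge
  have hpos : Tendsto (fun n ↦ canORBM (grid t n (firstIdx M t n ω)) ω) atTop (𝓝 z) :=
    ((continuous_canORBM ω).tendsto σ).comp hgrid
  -- eventually in `levelRegion M'`
  have hlev : Tendsto (fun n ↦ canLevel (grid t n (firstIdx M t n ω)) ω) atTop (𝓝 (canLevel σ ω)) :=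
    ((continuous_canLevel ω).tendsto σ).comp hgrid
  have hev : ∀ᶠ n in atTop, canORBM (grid t n (firstIdx M t n ω)) ω ∈ levelRegion M' := by
    have : canLevel σ ω < M' := lt_of_le_of_lt hzM.2.2 hMM'
    filter_upwards [hlev (Iio_mem_nhds this)] with n hn
    exact ⟨quadX_canORBM_nonneg _ ω, quadY_canORBM_nonneg _ ω, le_of_lt hn⟩
  -- modulus of continuity
  rw [Metric.tendsto_atTop]
  intro ε hε
  have hg : Tendsto (fun n ↦ 2 * D.C₁ * ‖canORBM (grid t n (firstIdx M t n ω)) ω - z‖ +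
      (2 * D.C₁ + D.ωbar) * ‖canORBM (grid t n (firstIdx M t n ω)) ω - z‖ ^ 2) atTop (𝓝 0) := by
    have hn : Tendsto (fun n ↦ ‖canORBM (grid t n (firstIdx M t n ω)) ω - z‖) atTop (𝓝 0) :=
      tendsto_iff_norm_sub_tendsto_zero.1 hpos
    have := (hn.const_mul (2 * D.C₁)).add ((hn.pow 2).const_mul (2 * D.C₁ + D.ωbar))
    simpa using this
  have hev2 := (Metric.tendsto_atTop.1 hg) ε hε
  obtain ⟨N₁, hN₁⟩ := hev2
  obtain ⟨N₂, hN₂⟩ := eventually_atTop.1 hev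
  refine ⟨max N₁ N₂, fun n hn ↦ ?_⟩
  have h1 := hN₁ n (le_of_max_le_left hn)
  have h2 := hN₂ n (le_of_max_le_right hn)
  rw [Real.dist_eq, sub_zero] at h1
  rw [Real.dist_eq, discreteStopped]
  have hb := D.abs_sub_le hzM' h2
  have hnn : 0 ≤ 2 * D.C₁ * ‖canORBM (grid t n (firstIdx M t n ω)) ω - z‖ +
      (2 * D.C₁ + D.ωbar) * ‖canORBM (grid t n (firstIdx M t n ω)) ω - z‖ ^ 2 := by
    have := D.C₁_nonneg; have := D.ωbar_nonneg; positivity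
  rw [abs_of_nonneg hnn] at h1
  exact hb.trans_lt h1

/-- **Bounded convergence of the expectations**: `E V_n → E F(Z_{t ∧ τ_M})`. [folklore] -/
theorem tendsto_integral_discreteStopped_stopped {M : ℝ} (hM : 0 < M) (hMM' : M < M') (t : ℝ≥0) :
    Tendsto (fun n ↦ ∫ ω, D.discreteStopped M t n ω ∂wienerPair) atTop
      (𝓝 (∫ ω, D.F (stoppedProcess canORBM (canHit M) t ω) ∂wienerPair)) := by
  haveI := isProbabilityMeasure_preWienerMeasure'
  refine tendsto_integral_of_dominated_convergence (fun _ ↦ D.C_F)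
    (fun n ↦ (D.measurable_discreteStopped M t n).aestronglyMeasurable) (integrable_const _)
    (fun n ↦ ae_of_all _ fun ω ↦ ?_) (ae_of_all _ fun ω ↦ D.tendsto_discreteStopped hM hMM' t ω)
  rw [Real.norm_eq_abs]
  exact D.absF_le _

end OrbmTestData

/-! ### Assembly: the expectation of the discretely stopped value -/

namespace OrbmTestData

variable {M' : ℝ} (D : OrbmTestData M')

/-- The `z`-independent part `K₀(h)` of the one-step bound. [folklore] -/
def stepConst (a : ℝ) (h : ℝ≥0) : ℝ :=
  25 * ∫ ω', D.ω (5 * stepSup h ω') * stepSup h ω' ^ 2 ∂wienerPair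
    + 2 * D.C_F * wienerPair.real (goodEvent (a / 2) h)ᶜ
    + 2 * D.C₁ * (2 / a + 1) * ∫ ω', stepSup h ω' ^ 2 * {ω' | a / 2 < stepSup h ω'}.indicator 1 ω' ∂wienerPair

/-- Auxiliary statement (`stepConst_nonneg`). [folklore] -/
theorem stepConst_nonneg {a : ℝ} (ha : 0 < a) (h : ℝ≥0) : 0 ≤ D.stepConst a h := by
  unfold stepConst
  have h1 : 0 ≤ ∫ ω', D.ω (5 * stepSup h ω') * stepSup h ω' ^ 2 ∂wienerPair :=
    integral_nonneg fun ω' ↦ mul_nonneg (D.ω_nonneg _) (sq_nonneg _)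
  have h2 : 0 ≤ wienerPair.real (goodEvent (a / 2) h)ᶜ := measureReal_nonneg
  have h3 : 0 ≤ ∫ ω', stepSup h ω' ^ 2 * {ω' | a / 2 < stepSup h ω'}.indicator (1 : WienerPair → ℝ) ω' ∂wienerPair :=
    integral_nonneg fun ω' ↦ mul_nonneg (sq_nonneg _) (indicator_one_nonneg _ _)
  have := D.C_F_nonneg; have := D.C₁_nonneg
  positivity

/-- The full one-step bound `B(z) = (4C₂+24C₁) ∫ S² J_z + K₀(h)` (non-negative for every `z`).
[folklore] -/
def stepBound (a : ℝ) (h : ℝ≥0) (z : ℂ) : ℝ :=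
  (4 * D.C₂ + 24 * D.C₁) * ∫ ω', stepSup h ω' ^ 2 * nearSides z h ω' ∂wienerPair + D.stepConst a h

/-- Auxiliary statement (`stepBound_nonneg`). [folklore] -/
theorem stepBound_nonneg {a : ℝ} (ha : 0 < a) (h : ℝ≥0) (z : ℂ) : 0 ≤ D.stepBound a h z := by
  unfold stepBound
  have := D.C₁_nonneg; have := D.C₂_nonneg; have := D.stepConst_nonneg ha h
  have := integral_nearSides_nonneg h z
  positivity

/-- Auxiliary statement (`stepBound_le`). [folklore] -/
theorem stepBound_le {a : ℝ} (h : ℝ≥0) (z : ℂ) :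
    D.stepBound a h z ≤ (4 * D.C₂ + 24 * D.C₁) * (2 * ∫ ω', stepSup h ω' ^ 2 ∂wienerPair) + D.stepConst a h := by
  unfold stepBound
  have := D.C₁_nonneg; have := D.C₂_nonneg
  have := integral_nearSides_le h z
  gcongr

/-- Auxiliary statement (`measurable_stepBound`). [folklore] -/
theorem measurable_stepBound (a : ℝ) (h : ℝ≥0) : Measurable (D.stepBound a h) :=
  ((measurable_integral_nearSides h).const_mul _).add_const _

/-- Auxiliary statement (`abs_oneStep_le_stepBound`). [folklore] -/
theorem abs_oneStep_le_stepBound {M a : ℝ} {z : ℂ} (hz : z ∈ levelRegion M) (h : ℝ≥0)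
    (hMa : M + 8 * a ≤ M') (ha : 0 < a) : |oneStep D.F h z| ≤ D.stepBound a h z := by
  have := D.abs_oneStep_le hz h hMa ha
  unfold stepBound stepConst
  linarith

/-- **Expectation of one term of the telescoping sum**: for `A = {t_k < τ_M}`,
`|E[𝟙_A (F(Z_{s+h}) − F(Z_s))]| ≤ E[B(Z_s)]`. [folklore] -/
theorem abs_integral_term_le {M a : ℝ} (hMa : M + 8 * a ≤ M') (ha : 0 < a) (s h : ℝ≥0) :
    |∫ ω, {ω | (s : WithTop ℝ≥0) < canHit M ω}.indicator 1 ω *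
        (D.F (canORBM (s + h) ω) - D.F (canORBM s ω)) ∂wienerPair| ≤
      ∫ ω, D.stepBound a h (canORBM s ω) ∂wienerPair := by
  haveI := isProbabilityMeasure_preWienerMeasure'
  rw [integral_indicator_mul_sub_eq D.measurableF D.absF_le s h (measurableSet_comap_coe_lt_canHit s M)]
  have hint : Integrable (fun ω ↦ D.stepBound a h (canORBM s ω)) wienerPair := by
    refine Integrable.of_bound ((D.measurable_stepBound a h).comp (measurable_canORBM s)).aestronglyMeasurable
      ((4 * D.C₂ + 24 * D.C₁) * (2 * ∫ ω', stepSup h ω' ^ 2 ∂wienerPair) + D.stepConst a h)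
      (ae_of_all _ fun ω ↦ ?_)
    rw [Real.norm_eq_abs, abs_of_nonneg (D.stepBound_nonneg ha h _)]
    exact D.stepBound_le h _
  have hle : ‖∫ ω, {ω | (s : WithTop ℝ≥0) < canHit M ω}.indicator (1 : WienerPair → ℝ) ω *
      oneStep D.F h (canORBM s ω) ∂wienerPair‖ ≤ ∫ ω, D.stepBound a h (canORBM s ω) ∂wienerPair := by
    refine norm_integral_le_of_norm_le hint (ae_of_all _ fun ω ↦ ?_)
    rw [Real.norm_eq_abs, abs_mul]
    by_cases hω : ω ∈ {ω | (s : WithTop ℝ≥0) < canHit M ω}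
    · rw [indicator_of_mem hω, Pi.one_apply, abs_one, one_mul]
      exact D.abs_oneStep_le_stepBound (canORBM_mem_levelRegion_of_coe_lt hω) h hMa ha
    · rw [indicator_of_notMem hω, abs_zero, zero_mul]
      exact D.stepBound_nonneg ha h _
  rwa [Real.norm_eq_abs] at hle

/-- `E[B(Z_s)] = (4C₂+24C₁) E[∫ S'² J_{Z_s}] + K₀(h)`. [folklore] -/
theorem integral_stepBound_canORBM (a : ℝ) (h s : ℝ≥0) :
    ∫ ω, D.stepBound a h (canORBM s ω) ∂wienerPair =
      (4 * D.C₂ + 24 * D.C₁) * ∫ ω, ∫ ω', stepSup h ω' ^ 2 * nearSides (canORBM s ω) h ω' ∂wienerPair ∂wienerPair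
        + D.stepConst a h := by
  haveI := isProbabilityMeasure_preWienerMeasure'
  unfold stepBound
  have hint : Integrable (fun ω ↦ ∫ ω', stepSup h ω' ^ 2 * nearSides (canORBM s ω) h ω' ∂wienerPair) wienerPair := by
    refine Integrable.of_bound ((measurable_integral_nearSides h).comp (measurable_canORBM s)).aestronglyMeasurable
      (2 * ∫ ω', stepSup h ω' ^ 2 ∂wienerPair) (ae_of_all _ fun ω ↦ ?_)
    rw [Real.norm_eq_abs, abs_of_nonneg (integral_nearSides_nonneg h _)]
    exact integral_nearSides_le h _
  rw [integral_add (hint.const_mul _) (integrable_const _), integral_const_mul, integral_const, smul_eq_mul,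
    probReal_univ, one_mul]

/-- **The expectation of the discretely stopped value, telescoped**:
`E V_n − F(0) = Σ_{k<n} E[𝟙{t_k<τ} (F(Z_{t_{k+1}}) − F(Z_{t_k}))]`. [folklore] -/
theorem integral_discreteStopped_sub (M : ℝ) (t : ℝ≥0) (n : ℕ) :
    (∫ ω, D.discreteStopped M t n ω ∂wienerPair) - D.F 0 =
      ∑ k ∈ Finset.range n, ∫ ω, {ω | (grid t n k : WithTop ℝ≥0) < canHit M ω}.indicator 1 ω *
        (D.F (canORBM (grid t n (k + 1)) ω) - D.F (canORBM (grid t n k) ω)) ∂wienerPair := by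
  haveI := isProbabilityMeasure_preWienerMeasure'
  have hterm : ∀ k, Integrable (fun ω ↦ {ω | (grid t n k : WithTop ℝ≥0) < canHit M ω}.indicator (1 : WienerPair → ℝ) ω *
      (D.F (canORBM (grid t n (k + 1)) ω) - D.F (canORBM (grid t n k) ω))) wienerPair := by
    intro k
    refine Integrable.of_bound ?_ (2 * D.C_F) (ae_of_all _ fun ω ↦ ?_)
    · exact (((measurable_indicator_const_iff 1).2 (measurableSet_coe_lt_canHit _ M)).mul
        ((D.measurableF.comp (measurable_canORBM _)).sub (D.measurableF.comp (measurable_canORBM _)))).aestronglyMeasurable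
    · rw [Real.norm_eq_abs, abs_mul]
      have h1 := abs_indicator_one_le {ω | (grid t n k : WithTop ℝ≥0) < canHit M ω} ω
      have h2 : |D.F (canORBM (grid t n (k + 1)) ω) - D.F (canORBM (grid t n k) ω)| ≤ 2 * D.C_F := by
        have := D.absF_le (canORBM (grid t n (k + 1)) ω); have := D.absF_le (canORBM (grid t n k) ω)
        calc _ ≤ |D.F (canORBM (grid t n (k + 1)) ω)| + |D.F (canORBM (grid t n k) ω)| := abs_sub _ _
          _ ≤ 2 * D.C_F := by linarith
      calc _ ≤ 1 * (2 * D.C_F) := mul_le_mul h1 h2 (abs_nonneg _) zero_le_one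
        _ = 2 * D.C_F := one_mul _
  have hdisc : Integrable (D.discreteStopped M t n) wienerPair :=
    Integrable.of_bound (D.measurable_discreteStopped M t n).aestronglyMeasurable D.C_F
      (ae_of_all _ fun ω ↦ by rw [Real.norm_eq_abs]; exact D.absF_le _)
  have h0 : ∫ ω, D.F (canORBM 0 ω) ∂wienerPair = D.F 0 := by
    simp only [canORBM_zero, integral_const, smul_eq_mul, probReal_univ, one_mul]
  have hc : Integrable (fun ω ↦ D.F (canORBM 0 ω)) wienerPair :=
    (integrable_const (D.F 0)).congr (ae_of_all _ fun ω ↦ by simp)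
  rw [← h0, ← integral_sub hdisc hc, ← integral_finsetSum _ fun k _ ↦ hterm k]
  refine integral_congr_ae (ae_of_all _ fun ω ↦ ?_)
  exact D.discreteStopped_sub_eq_sum M t n ω

/-- **First bound on `|E V_n − F(0)|`**:
`≤ (4C₂+24C₁) Σ_{k<n} E[∫ S'² J_{Z_{t_k}}] + n K₀(h)`. [folklore] -/
theorem abs_integral_discreteStopped_sub_le {M a : ℝ} (hMa : M + 8 * a ≤ M') (ha : 0 < a) (t : ℝ≥0) (n : ℕ) :
    |(∫ ω, D.discreteStopped M t n ω ∂wienerPair) - D.F 0| ≤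
      (4 * D.C₂ + 24 * D.C₁) * ∑ k ∈ Finset.range n,
          ∫ ω, ∫ ω', stepSup (mesh t n) ω' ^ 2 * nearSides (canORBM (grid t n k) ω) (mesh t n) ω'
            ∂wienerPair ∂wienerPair
        + n * D.stepConst a (mesh t n) := by
  rw [D.integral_discreteStopped_sub M t n]
  refine (Finset.abs_sum_le_sum_abs _ _).trans ?_
  have hk : ∀ k ∈ Finset.range n,
      |∫ ω, {ω | (grid t n k : WithTop ℝ≥0) < canHit M ω}.indicator (1 : WienerPair → ℝ) ω *
        (D.F (canORBM (grid t n (k + 1)) ω) - D.F (canORBM (grid t n k) ω)) ∂wienerPair| ≤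
      (4 * D.C₂ + 24 * D.C₁) * ∫ ω, ∫ ω', stepSup (mesh t n) ω' ^ 2 *
          nearSides (canORBM (grid t n k) ω) (mesh t n) ω' ∂wienerPair ∂wienerPair + D.stepConst a (mesh t n) := by
    intro k _
    rw [grid_succ]
    exact (D.abs_integral_term_le hMa ha _ _).trans (le_of_eq (D.integral_stepBound_canORBM a _ _))
  refine (Finset.sum_le_sum hk).trans (le_of_eq ?_)
  rw [Finset.sum_add_distrib, Finset.mul_sum, Finset.sum_const, Finset.card_range, nsmul_eq_mul]

end OrbmTestData

/-! ### The grid sum of the `z`-dependent term -/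

namespace OrbmTestData

variable {M' : ℝ} (D : OrbmTestData M')

/-- The tail constant `c_T = (16/3)·(2·(512/9)·16)`. [folklore] -/
def cT : ℝ := 16 / 3 * (2 * (512 / 9 * 16))

/-- Auxiliary statement (`cT_pos`). [folklore] -/
theorem cT_pos : 0 < cT := by unfold cT; norm_num

/-- The second-moment tail bound in terms of `c_T`. [folklore] -/
theorem integral_stepSup_sq_indicator_le' (h : ℝ≥0) {m : ℝ} (hm : 8 * Real.sqrt h ≤ m) (hm0 : 0 < m) :
    ∫ ω', stepSup h ω' ^ 2 * {ω' | m < stepSup h ω'}.indicator (1 : WienerPair → ℝ) ω' ∂wienerPair ≤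
      cT * (h : ℝ) ^ 2 / m ^ 2 := by
  have := integral_stepSup_sq_indicator_le h hm hm0
  unfold cT
  convert this using 1
  ring

/-- Real form of the occupation estimate: `P(y(Z_s) < 2σ) ≤ min 1 (2√(2σ/√s))` (`s, σ > 0`), and the
same for `x`. [folklore] -/
theorem measureReal_quad_lt_le {s : ℝ≥0} (hs : 0 < s) {σ : ℝ} (hσ : 0 < σ) :
    wienerPair.real {ω | quadY (canORBM s ω) < 2 * σ} ≤ min 1 (2 * Real.sqrt (2 * σ / Real.sqrt s)) ∧
    wienerPair.real {ω | quadX (canORBM s ω) < 2 * σ} ≤ min 1 (2 * Real.sqrt (2 * σ / Real.sqrt s)) := by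
  haveI := isProbabilityMeasure_preWienerMeasure'
  have hy := measure_quadY_canORBM_lt_le hs (by positivity : 0 < 2 * σ)
  have hx := measure_quadX_canORBM_lt_le hs (by positivity : 0 < 2 * σ)
  constructor
  · refine le_min measureReal_le_one ?_
    rw [measureReal_def]
    refine (ENNReal.toReal_mono ENNReal.ofReal_ne_top hy).trans ?_
    rw [ENNReal.toReal_ofReal (by positivity)]
  · refine le_min measureReal_le_one ?_
    rw [measureReal_def]
    refine (ENNReal.toReal_mono ENNReal.ofReal_ne_top hx).trans ?_
    rw [ENNReal.toReal_ofReal (by positivity)]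

/-- **Bound of the `z`-dependent term at one grid time `s ≥ δ > 0`**:
`E[∫ S'² J_{Z_s}] ≤ 2 ∫ S'² 𝟙{m₀ < S'} + 4√(2m₀/√δ) ∫ S'²`. [folklore] -/
theorem integral_integral_nearSides_le_of_le {s : ℝ≥0} {δ m₀ : ℝ} (hδ : 0 < δ) (hsδ : δ ≤ s) (hm₀ : 0 < m₀) (h : ℝ≥0) :
    ∫ ω, ∫ ω', stepSup h ω' ^ 2 * nearSides (canORBM s ω) h ω' ∂wienerPair ∂wienerPair ≤
      2 * ∫ ω', stepSup h ω' ^ 2 * {ω' | m₀ < stepSup h ω'}.indicator 1 ω' ∂wienerPair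
        + 4 * Real.sqrt (2 * m₀ / Real.sqrt δ) * ∫ ω', stepSup h ω' ^ 2 ∂wienerPair := by
  haveI := isProbabilityMeasure_preWienerMeasure'
  have hs : 0 < s := by
    have : (0 : ℝ) < s := hδ.trans_le hsδ
    exact_mod_cast this
  rw [integral_integral_nearSides_canORBM]
  have hS2 := integrable_stepSup_sq h
  have hmS := measurable_stepSup h
  have i4 : Integrable (fun ω' ↦ stepSup h ω' ^ 2 * {ω' | m₀ < stepSup h ω'}.indicator (1 : WienerPair → ℝ) ω')
      wienerPair := by
    refine (hS2.mono' ((hmS.pow_const 2).mul ((measurable_indicator_const_iff 1).2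
        (measurableSet_lt measurable_const hmS))).aestronglyMeasurable (ae_of_all _ fun ω' ↦ ?_))
    rw [Real.norm_eq_abs, abs_mul, abs_of_nonneg (sq_nonneg (stepSup h ω'))]
    have := abs_indicator_one_le {ω' | m₀ < stepSup h ω'} ω'
    nlinarith [sq_nonneg (stepSup h ω'), abs_nonneg ({ω' | m₀ < stepSup h ω'}.indicator (1 : WienerPair → ℝ) ω')]
  have hrhs : Integrable (fun ω' ↦ 2 * (stepSup h ω' ^ 2 * {ω' | m₀ < stepSup h ω'}.indicator (1 : WienerPair → ℝ) ω')
      + 4 * Real.sqrt (2 * m₀ / Real.sqrt δ) * stepSup h ω' ^ 2) wienerPair := (i4.const_mul 2).add (hS2.const_mul _)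
  rw [← integral_const_mul, ← integral_const_mul, ← integral_add (i4.const_mul 2) (hS2.const_mul _)]
  refine integral_mono_of_nonneg (ae_of_all _ fun ω' ↦ ?_) hrhs (ae_of_all _ fun ω' ↦ ?_)
  · exact mul_nonneg (sq_nonneg _) (add_nonneg measureReal_nonneg measureReal_nonneg)
  simp only
  set σ := stepSup h ω' with hσ
  have hσ0 : 0 ≤ σ := stepSup_nonneg h ω'
  have hsq : 0 ≤ Real.sqrt (2 * m₀ / Real.sqrt δ) := Real.sqrt_nonneg _
  rcases hσ0.eq_or_lt with h0 | hpos
  · rw [← h0]; simp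
  have ⟨hy, hx⟩ := measureReal_quad_lt_le hs hpos
  by_cases hc : m₀ < σ
  · rw [indicator_of_mem (by exact hc), Pi.one_apply, mul_one]
    have h1 : wienerPair.real {ω | quadY (canORBM s ω) < 2 * σ} ≤ 1 := hy.trans (min_le_left _ _)
    have h2 : wienerPair.real {ω | quadX (canORBM s ω) < 2 * σ} ≤ 1 := hx.trans (min_le_left _ _)
    nlinarith [sq_nonneg σ]
  · rw [indicator_of_notMem (by exact hc), mul_zero, mul_zero, zero_add]
    have hσm : σ ≤ m₀ := not_lt.1 hc
    have hsδ' : Real.sqrt δ ≤ Real.sqrt s := Real.sqrt_le_sqrt (by exact_mod_cast hsδ)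
    have hδs : 0 < Real.sqrt δ := Real.sqrt_pos.2 hδ
    have hmono : 2 * Real.sqrt (2 * σ / Real.sqrt s) ≤ 2 * Real.sqrt (2 * m₀ / Real.sqrt δ) := by
      gcongr 2 * Real.sqrt ?_
      calc 2 * σ / Real.sqrt s ≤ 2 * m₀ / Real.sqrt s := by gcongr
        _ ≤ 2 * m₀ / Real.sqrt δ := div_le_div_of_nonneg_left (by positivity) hδs hsδ'
    have h1 : wienerPair.real {ω | quadY (canORBM s ω) < 2 * σ} ≤ 2 * Real.sqrt (2 * m₀ / Real.sqrt δ) :=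
      (hy.trans (min_le_right _ _)).trans hmono
    have h2 : wienerPair.real {ω | quadX (canORBM s ω) < 2 * σ} ≤ 2 * Real.sqrt (2 * m₀ / Real.sqrt δ) :=
      (hx.trans (min_le_right _ _)).trans hmono
    nlinarith [sq_nonneg σ]

/-- **Bound of the `z`-dependent term at any grid time**: `E[∫ S'² J_{Z_s}] ≤ 32 h`. [folklore] -/
theorem integral_integral_nearSides_le (s h : ℝ≥0) :
    ∫ ω, ∫ ω', stepSup h ω' ^ 2 * nearSides (canORBM s ω) h ω' ∂wienerPair ∂wienerPair ≤ 32 * (h : ℝ) := by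
  haveI := isProbabilityMeasure_preWienerMeasure'
  have h1 : ∫ ω, ∫ ω', stepSup h ω' ^ 2 * nearSides (canORBM s ω) h ω' ∂wienerPair ∂wienerPair ≤
      ∫ ω, 2 * ∫ ω', stepSup h ω' ^ 2 ∂wienerPair ∂wienerPair := by
    refine integral_mono_of_nonneg (ae_of_all _ fun ω ↦ integral_nearSides_nonneg h _) (integrable_const _)
      (ae_of_all _ fun ω ↦ integral_nearSides_le h _)
  rw [integral_const, smul_eq_mul, probReal_univ, one_mul] at h1
  have := integral_stepSup_sq_le h
  linarith

/-- Counting the grid times below `δ`: `#{k < n : k h < δ} ≤ δ/h + 1` (`h > 0`). [folklore] -/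
theorem sum_ite_grid_lt_le {t : ℝ≥0} {n : ℕ} {δ : ℝ} (hδ : 0 < δ) (hh : 0 < (mesh t n : ℝ)) :
    ∑ k ∈ Finset.range n, (if ((grid t n k : ℝ≥0) : ℝ) < δ then (1 : ℝ) else 0) ≤ δ / mesh t n + 1 := by
  set h := mesh t n with hhdef
  rw [← Finset.sum_filter]
  simp only [Finset.sum_const, nsmul_eq_mul, mul_one]
  have hsub : (Finset.range n).filter (fun k ↦ ((grid t n k : ℝ≥0) : ℝ) < δ) ⊆ Finset.range (⌊δ / h⌋₊ + 1) := by
    intro k hk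
    rw [Finset.mem_filter] at hk
    rw [Finset.mem_range]
    have hk' : (k : ℝ) * h < δ := by
      have : ((grid t n k : ℝ≥0) : ℝ) = k * h := by simp [grid, hhdef]
      rw [← this]; exact hk.2
    have hlt : (k : ℝ) < δ / h := by rw [lt_div_iff₀ hh]; exact hk'
    by_contra hge
    rw [not_lt] at hge
    have : (⌊δ / h⌋₊ : ℝ) + 1 ≤ k := by exact_mod_cast hge
    have := Nat.lt_floor_add_one (δ / h)
    linarith
  calc (((Finset.range n).filter (fun k ↦ ((grid t n k : ℝ≥0) : ℝ) < δ)).card : ℝ)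
      ≤ ((Finset.range (⌊δ / h⌋₊ + 1)).card : ℝ) := by exact_mod_cast Finset.card_le_card hsub
    _ = ⌊δ / h⌋₊ + 1 := by rw [Finset.card_range]; push_cast; ring
    _ ≤ δ / h + 1 := by
        have := Nat.floor_le (by positivity : 0 ≤ δ / h)
        linarith

/-- **The grid sum of the `z`-dependent term**: for `δ, m₀ > 0`, `8√h ≤ m₀`, `h = t/n > 0`,
`Σ_{k<n} E[∫ S'² J_{Z_{t_k}}] ≤ 32(δ + h) + 2 c_T t h/m₀² + 64 t √(2m₀/√δ)`. [folklore] -/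
theorem sum_integral_nearSides_le {t : ℝ≥0} {n : ℕ} (hn : n ≠ 0) (ht : 0 < t) {δ m₀ : ℝ} (hδ : 0 < δ)
    (hm₀ : 0 < m₀) (hhm : 8 * Real.sqrt (mesh t n) ≤ m₀) :
    ∑ k ∈ Finset.range n, ∫ ω, ∫ ω', stepSup (mesh t n) ω' ^ 2 * nearSides (canORBM (grid t n k) ω) (mesh t n) ω'
        ∂wienerPair ∂wienerPair ≤
      32 * (δ + mesh t n) + 2 * cT * t * mesh t n / m₀ ^ 2 + 64 * t * Real.sqrt (2 * m₀ / Real.sqrt δ) := by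
  set h := mesh t n with hh
  have hhR : (h : ℝ) = t / n := coe_mesh t n
  have hnR : (0 : ℝ) < n := by exact_mod_cast Nat.pos_of_ne_zero hn
  have htR : (0 : ℝ) < t := by exact_mod_cast ht
  have hnh : (n : ℝ) * h = t := by rw [hhR]; field_simp
  have hhpos : (0 : ℝ) < h := by rw [hhR]; positivity
  set R : ℝ := 2 * (cT * (h : ℝ) ^ 2 / m₀ ^ 2) + 4 * Real.sqrt (2 * m₀ / Real.sqrt δ) * (16 * h) with hR
  have hT : ∫ ω', stepSup h ω' ^ 2 * {ω' | m₀ < stepSup h ω'}.indicator (1 : WienerPair → ℝ) ω' ∂wienerPair ≤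
      cT * (h : ℝ) ^ 2 / m₀ ^ 2 := integral_stepSup_sq_indicator_le' h hhm hm₀
  have hterm : ∀ k ∈ Finset.range n,
      ∫ ω, ∫ ω', stepSup h ω' ^ 2 * nearSides (canORBM (grid t n k) ω) h ω' ∂wienerPair ∂wienerPair ≤
        32 * h * (if ((grid t n k : ℝ≥0) : ℝ) < δ then 1 else 0) + R := by
    intro k _
    have hR0 : 0 ≤ R := by have := cT_pos; positivity
    by_cases hk : ((grid t n k : ℝ≥0) : ℝ) < δ
    · rw [if_pos hk, mul_one]
      exact (integral_integral_nearSides_le _ h).trans (by linarith)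
    · rw [if_neg hk, mul_zero, zero_add]
      have hge : δ ≤ ((grid t n k : ℝ≥0) : ℝ) := not_lt.1 hk
      refine (integral_integral_nearSides_le_of_le hδ hge hm₀ h).trans ?_
      have := integral_stepSup_sq_le h
      rw [hR]
      gcongr
  refine (Finset.sum_le_sum hterm).trans ?_
  rw [Finset.sum_add_distrib, Finset.sum_const, Finset.card_range, nsmul_eq_mul, ← Finset.mul_sum]
  have hcount := sum_ite_grid_lt_le (t := t) (n := n) hδ hhpos
  rw [← hh] at hcount
  have h1 : 32 * (h : ℝ) * ∑ k ∈ Finset.range n, (if ((grid t n k : ℝ≥0) : ℝ) < δ then (1:ℝ) else 0) ≤ 32 * (δ + h) := by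
    calc 32 * (h : ℝ) * ∑ k ∈ Finset.range n, (if ((grid t n k : ℝ≥0) : ℝ) < δ then (1:ℝ) else 0)
        ≤ 32 * (h : ℝ) * (δ / h + 1) := by gcongr
      _ = 32 * (δ + h) := by field_simp
  have h2 : (n : ℝ) * R = 2 * cT * t * h / m₀ ^ 2 + 64 * t * Real.sqrt (2 * m₀ / Real.sqrt δ) := by
    rw [hR, ← hnh]; ring
  linarith

/-! ### The `z`-independent constant -/

/-- **Bound of `K₀(h)`** under the threshold conditions `8√h ≤ m₁`, `8√h ≤ a/2`, `h ≤ a²/8`: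
`K₀(h) ≤ 25(16 h ω(5m₁) + ω̄ c_T h²/m₁²) + 2C_F · 256 h²/a⁴ + 2C₁(2/a+1) c_T h²/(a/2)²`. [folklore] -/
theorem stepConst_le {a m₁ : ℝ} (ha : 0 < a) (hm₁ : 0 < m₁) (h : ℝ≥0) (hh1 : 8 * Real.sqrt h ≤ m₁)
    (hh2 : 8 * Real.sqrt h ≤ a / 2) (hh3 : (h : ℝ) ≤ a ^ 2 / 8) :
    D.stepConst a h ≤ 25 * (16 * (h : ℝ) * D.ω (5 * m₁) + D.ωbar * (cT * (h : ℝ) ^ 2 / m₁ ^ 2))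
      + 2 * D.C_F * (256 * (h : ℝ) ^ 2 / a ^ 4) + 2 * D.C₁ * (2 / a + 1) * (cT * (h : ℝ) ^ 2 / (a / 2) ^ 2) := by
  unfold stepConst
  have e1 := D.integral_ω_stepSup_le h m₁
  have e1a := integral_stepSup_sq_le h
  have e1b : ∫ ω', stepSup h ω' ^ 2 * {ω' | m₁ < stepSup h ω'}.indicator (1 : WienerPair → ℝ) ω' ∂wienerPair ≤
      cT * (h : ℝ) ^ 2 / m₁ ^ 2 := integral_stepSup_sq_indicator_le' h hh1 hm₁
  have e2 := measureReal_compl_goodEvent_le ha h hh3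
  have e3 : ∫ ω', stepSup h ω' ^ 2 * {ω' | a / 2 < stepSup h ω'}.indicator (1 : WienerPair → ℝ) ω' ∂wienerPair ≤
      cT * (h : ℝ) ^ 2 / (a / 2) ^ 2 := integral_stepSup_sq_indicator_le' h hh2 (by positivity)
  have hω := D.ω_nonneg (5 * m₁)
  have hωb := D.ωbar_nonneg
  have hCF := D.C_F_nonneg
  have hC₁ := D.C₁_nonneg
  have ha' : 0 ≤ 2 / a + 1 := by positivity
  have t1 : ∫ ω', D.ω (5 * stepSup h ω') * stepSup h ω' ^ 2 ∂wienerPair ≤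
      16 * (h : ℝ) * D.ω (5 * m₁) + D.ωbar * (cT * (h : ℝ) ^ 2 / m₁ ^ 2) := by
    refine e1.trans ?_
    nlinarith
  nlinarith [mul_le_mul_of_nonneg_left e3 (by positivity : (0:ℝ) ≤ 2 * D.C₁ * (2 / a + 1)),
    mul_le_mul_of_nonneg_left e2 (by positivity : (0:ℝ) ≤ 2 * D.C_F)]

end OrbmTestData

/-! ### The limit `E V_n → F(0)` and the stopped Dynkin identity -/

namespace OrbmTestData

variable {M' : ℝ} (D : OrbmTestData M')

/-- `8 √h ≤ m` whenever `h ≤ m²/64` (`m ≥ 0`). [folklore] -/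
theorem eight_mul_sqrt_le {h m : ℝ} (hm : 0 ≤ m) (hh : h ≤ m ^ 2 / 64) : 8 * Real.sqrt h ≤ m := by
  have : Real.sqrt h ≤ Real.sqrt (m ^ 2 / 64) := Real.sqrt_le_sqrt hh
  rw [show m ^ 2 / 64 = (m / 8) ^ 2 by ring, Real.sqrt_sq (by positivity)] at this
  linarith

/-- A constant multiple of the mesh is eventually small. [folklore] -/
theorem eventually_const_mul_mesh_lt (t : ℝ≥0) (c : ℝ) {ε : ℝ} (hε : 0 < ε) :
    ∀ᶠ n : ℕ in atTop, c * ((t : ℝ) / n) < ε := by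
  have hlim : Tendsto (fun n : ℕ ↦ c * ((t : ℝ) / n)) atTop (𝓝 (c * 0)) :=
    (tendsto_const_div_atTop_nhds_zero_nat _).const_mul c
  rw [mul_zero] at hlim
  exact hlim.eventually (gt_mem_nhds hε)

set_option maxHeartbeats 800000 in
/-- **`E V_n → F(0)`**: the expectation of the discretely stopped value tends to `F(0)` as the mesh
goes to zero (`M + 8a ≤ M'`, `a > 0`, `t > 0`). [folklore] -/
theorem tendsto_integral_discreteStopped {M a : ℝ} (hMa : M + 8 * a ≤ M') (ha : 0 < a) {t : ℝ≥0}
    (ht : 0 < t) :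
    Tendsto (fun n ↦ ∫ ω, D.discreteStopped M t n ω ∂wienerPair) atTop (𝓝 (D.F 0)) := by
  have htR : (0 : ℝ) < t := by exact_mod_cast ht
  have hK : 0 ≤ 4 * D.C₂ + 24 * D.C₁ := by linarith [D.C₁_nonneg, D.C₂_nonneg]
  set K := 4 * D.C₂ + 24 * D.C₁ with hKdef
  have hcT := cT_pos
  have hωb := D.ωbar_nonneg; have hCF := D.C_F_nonneg; have hC₁ := D.C₁_nonneg
  rw [Metric.tendsto_atTop]
  intro ε hε
  -- Step A: `m₁`
  set ε₁ : ℝ := ε / (8 * (400 * t + 1)) with hε₁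
  have hε₁pos : 0 < ε₁ := by positivity
  obtain ⟨r, hr, hrω⟩ := Metric.tendsto_nhdsWithin_nhds.1 D.ω_tendsto ε₁ hε₁pos
  set m₁ : ℝ := r / 10 with hm₁
  have hm₁pos : 0 < m₁ := by positivity
  have hωm₁ : D.ω (5 * m₁) < ε₁ := by
    have := hrω (show 5 * m₁ ∈ Set.Ioi (0:ℝ) by rw [Set.mem_Ioi]; positivity) (by
      rw [Real.dist_eq, sub_zero, abs_of_pos (by positivity)]; rw [hm₁]; linarith)
    rw [Real.dist_eq, sub_zero] at this
    exact (le_abs_self _).trans_lt this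
  -- Step B: `δ`
  set δ : ℝ := ε / (8 * (32 * K + 1)) with hδ
  have hδpos : 0 < δ := by positivity
  have hKδ : K * (32 * δ) ≤ ε / 8 := by
    rw [hδ]
    rw [show K * (32 * (ε / (8 * (32 * K + 1)))) = ε / 8 * (32 * K / (32 * K + 1)) by field_simp]
    have : 32 * K / (32 * K + 1) ≤ 1 := (div_le_one (by positivity)).2 (by linarith)
    nlinarith
  -- Step C: `m₀`
  set g : ℝ → ℝ := fun m ↦ K * (64 * t * Real.sqrt (2 * m / Real.sqrt δ)) with hg
  have hgc : Continuous g := by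
    have : Continuous fun m : ℝ ↦ Real.sqrt (2 * m / Real.sqrt δ) :=
      Real.continuous_sqrt.comp ((continuous_const.mul continuous_id).div_const _)
    fun_prop
  have hg0 : g 0 = 0 := by simp [hg]
  have hgev : ∀ᶠ m in 𝓝 (0:ℝ), g m < ε / 8 := by
    have := hgc.tendsto 0
    rw [hg0] at this
    exact this.eventually (gt_mem_nhds (by positivity))
  obtain ⟨ρ, hρ, hρg⟩ := Metric.eventually_nhds_iff.1 hgev
  set m₀ : ℝ := ρ / 2 with hm₀
  have hm₀pos : 0 < m₀ := by positivity
  have hgm₀ : K * (64 * t * Real.sqrt (2 * m₀ / Real.sqrt δ)) < ε / 8 := by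
    have := hρg (y := m₀) (by rw [Real.dist_eq, sub_zero, abs_of_pos hm₀pos, hm₀]; linarith)
    simpa [hg] using this
  -- Step D: thresholds in `n`
  have e1 := eventually_const_mul_mesh_lt t 1 (by positivity : (0:ℝ) < m₀ ^ 2 / 64)
  have e2 := eventually_const_mul_mesh_lt t 1 (by positivity : (0:ℝ) < m₁ ^ 2 / 64)
  have e3 := eventually_const_mul_mesh_lt t 1 (by positivity : (0:ℝ) < (a / 2) ^ 2 / 64)
  have e4 := eventually_const_mul_mesh_lt t 1 (by positivity : (0:ℝ) < a ^ 2 / 8)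
  have e5 := eventually_const_mul_mesh_lt t (K * 32) (by positivity : (0:ℝ) < ε / 8)
  have e6 := eventually_const_mul_mesh_lt t (K * (2 * cT * t / m₀ ^ 2)) (by positivity : (0:ℝ) < ε / 8)
  have e7 := eventually_const_mul_mesh_lt t (25 * D.ωbar * cT * t / m₁ ^ 2) (by positivity : (0:ℝ) < ε / 8)
  have e8 := eventually_const_mul_mesh_lt t (512 * D.C_F * t / a ^ 4) (by positivity : (0:ℝ) < ε / 8)
  have e9 := eventually_const_mul_mesh_lt t (2 * D.C₁ * (2 / a + 1) * cT * t / (a / 2) ^ 2)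
    (by positivity : (0:ℝ) < ε / 8)
  obtain ⟨N, hN⟩ := eventually_atTop.1 ((((((((e1.and e2).and e3).and e4).and e5).and e6).and e7).and e8).and
    (e9.and (eventually_ne_atTop 0)))
  refine ⟨N, fun n hn ↦ ?_⟩
  obtain ⟨⟨⟨⟨⟨⟨⟨⟨c1, c2⟩, c3⟩, c4⟩, c5⟩, c6⟩, c7⟩, c8⟩, c9, hn0⟩ := hN n hn
  rw [one_mul] at c1 c2 c3 c4
  -- the mesh
  set hR : ℝ := (t : ℝ) / n with hhR
  have hmesh : ((mesh t n : ℝ≥0) : ℝ) = hR := coe_mesh t n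
  have hnR : (0 : ℝ) < n := by exact_mod_cast Nat.pos_of_ne_zero hn0
  have hnh : (n : ℝ) * hR = t := by rw [hhR]; field_simp
  have hhRpos : 0 < hR := by positivity
  -- threshold facts
  have t1 : 8 * Real.sqrt (mesh t n) ≤ m₀ := by rw [hmesh]; exact eight_mul_sqrt_le hm₀pos.le c1.le
  have t2 : 8 * Real.sqrt (mesh t n) ≤ m₁ := by rw [hmesh]; exact eight_mul_sqrt_le hm₁pos.le c2.le
  have t3 : 8 * Real.sqrt (mesh t n) ≤ a / 2 := by rw [hmesh]; exact eight_mul_sqrt_le (by positivity) c3.le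
  have t4 : ((mesh t n : ℝ≥0) : ℝ) ≤ a ^ 2 / 8 := by rw [hmesh]; exact c4.le
  -- the two main bounds
  have B1 := D.abs_integral_discreteStopped_sub_le hMa ha t n (M := M)
  have B2 := sum_integral_nearSides_le hn0 ht hδpos hm₀pos t1
  have B3 := D.stepConst_le ha hm₁pos (mesh t n) t2 t3 t4
  rw [hmesh] at B2 B3
  -- rewrite the `n · (…)` term using `n hR = t`
  have B3' : (n : ℝ) * D.stepConst a (mesh t n) ≤
      25 * (16 * t * D.ω (5 * m₁) + D.ωbar * (cT * t * hR / m₁ ^ 2))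
        + 2 * D.C_F * (256 * t * hR / a ^ 4) + 2 * D.C₁ * (2 / a + 1) * (cT * t * hR / (a / 2) ^ 2) := by
    have := mul_le_mul_of_nonneg_left B3 hnR.le
    have e : (n : ℝ) * (25 * (16 * hR * D.ω (5 * m₁) + D.ωbar * (cT * hR ^ 2 / m₁ ^ 2))
        + 2 * D.C_F * (256 * hR ^ 2 / a ^ 4) + 2 * D.C₁ * (2 / a + 1) * (cT * hR ^ 2 / (a / 2) ^ 2)) =
        25 * (16 * t * D.ω (5 * m₁) + D.ωbar * (cT * t * hR / m₁ ^ 2))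
        + 2 * D.C_F * (256 * t * hR / a ^ 4) + 2 * D.C₁ * (2 / a + 1) * (cT * t * hR / (a / 2) ^ 2) := by
      rw [← hnh]; ring
    linarith
  have hsum0 : 0 ≤ ∑ k ∈ Finset.range n, ∫ ω, ∫ ω', stepSup (mesh t n) ω' ^ 2 *
      nearSides (canORBM (grid t n k) ω) (mesh t n) ω' ∂wienerPair ∂wienerPair :=
    Finset.sum_nonneg fun k _ ↦ integral_nonneg fun ω ↦ integral_nearSides_nonneg _ _
  have B2' : K * ∑ k ∈ Finset.range n, ∫ ω, ∫ ω', stepSup (mesh t n) ω' ^ 2 *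
      nearSides (canORBM (grid t n k) ω) (mesh t n) ω' ∂wienerPair ∂wienerPair ≤
      K * (32 * (δ + hR) + 2 * cT * t * hR / m₀ ^ 2 + 64 * t * Real.sqrt (2 * m₀ / Real.sqrt δ)) :=
    mul_le_mul_of_nonneg_left B2 hK
  -- the eight pieces
  have p1 : 25 * (16 * t * D.ω (5 * m₁)) ≤ ε / 8 := by
    have : 400 * (t : ℝ) * ε₁ ≤ ε / 8 := by
      rw [hε₁, show 400 * (t:ℝ) * (ε / (8 * (400 * t + 1))) = ε / 8 * (400 * t / (400 * t + 1)) by field_simp]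
      have : 400 * (t:ℝ) / (400 * t + 1) ≤ 1 := (div_le_one (by positivity)).2 (by linarith)
      nlinarith
    have hω0 := D.ω_nonneg (5 * m₁)
    nlinarith
  have p2 : 25 * (D.ωbar * (cT * t * hR / m₁ ^ 2)) < ε / 8 := by
    have : 25 * (D.ωbar * (cT * t * hR / m₁ ^ 2)) = 25 * D.ωbar * cT * t / m₁ ^ 2 * hR := by ring
    rw [this]; exact c7
  have p3 : 2 * D.C_F * (256 * t * hR / a ^ 4) < ε / 8 := by
    have : 2 * D.C_F * (256 * t * hR / a ^ 4) = 512 * D.C_F * t / a ^ 4 * hR := by ring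
    rw [this]; exact c8
  have p4 : 2 * D.C₁ * (2 / a + 1) * (cT * t * hR / (a / 2) ^ 2) < ε / 8 := by
    have : 2 * D.C₁ * (2 / a + 1) * (cT * t * hR / (a / 2) ^ 2) = 2 * D.C₁ * (2 / a + 1) * cT * t / (a / 2) ^ 2 * hR := by
      ring
    rw [this]; exact c9
  have p5 : K * (32 * hR) < ε / 8 := by rw [show K * (32 * hR) = K * 32 * hR by ring]; exact c5
  have p6 : K * (2 * cT * t * hR / m₀ ^ 2) < ε / 8 := by
    rw [show K * (2 * cT * t * hR / m₀ ^ 2) = K * (2 * cT * t / m₀ ^ 2) * hR by ring]; exact c6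
  rw [Real.dist_eq]
  have total : |(∫ ω, D.discreteStopped M t n ω ∂wienerPair) - D.F 0| < ε := by
    have hexp : K * (32 * (δ + hR) + 2 * cT * t * hR / m₀ ^ 2 + 64 * t * Real.sqrt (2 * m₀ / Real.sqrt δ)) =
        K * (32 * δ) + K * (32 * hR) + K * (2 * cT * t * hR / m₀ ^ 2) +
          K * (64 * t * Real.sqrt (2 * m₀ / Real.sqrt δ)) := by ring
    linarith [B1, B2', B3', hexp, p1, p2, p3, p4, p5, p6, hKδ, hgm₀]
  exact total

/-- **The stopped Dynkin identity for the canonical obliquely reflected Brownian motion.** For test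
data `D` on `levelRegion M'` (bounded measurable `F` with uniform second-order Taylor data, harmonic,
oblique boundary conditions `∂_ζ F = 0` on `{y = 0}` and `∂₁ F = 0` on `{x = 0}` in Lipschitz
form), `0 < M`, `0 < a`, `M + 8a ≤ M'`, and every `t ≥ 0`:
`E[ F(Z_{t ∧ τ_M}) ] = F(0)`, where `Z = canORBM` and `τ_M = canHit M` is the hitting time of the
level `M`. (Le Gall 2016, Thm. 6.14-type martingale statement for the reflected process, proved by
discretisation: telescoping + one-step Markov identity + occupation estimates.) [folklore] -/
theorem integral_stoppedProcess_canORBM_eq {M a : ℝ} (hM : 0 < M) (hMa : M + 8 * a ≤ M') (ha : 0 < a)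
    (t : ℝ≥0) : ∫ ω, D.F (stoppedProcess canORBM (canHit M) t ω) ∂wienerPair = D.F 0 := by
  haveI := isProbabilityMeasure_preWienerMeasure'
  rcases eq_or_ne t 0 with rfl | ht
  · have : ∀ ω, stoppedProcess canORBM (canHit M) 0 ω = 0 := by
      intro ω
      rw [stoppedProcess_canORBM_eq]
      have : stopTime M 0 ω = 0 := le_antisymm (stopTime_le M 0 ω) bot_le
      rw [this, canORBM_zero]
    simp only [this, integral_const, smul_eq_mul, probReal_univ, one_mul]
  · have ht' : 0 < t := pos_iff_ne_zero.2 ht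
    have hMM' : M < M' := by linarith
    exact tendsto_nhds_unique (D.tendsto_integral_discreteStopped_stopped hM hMM' t)
      (D.tendsto_integral_discreteStopped hMa ha ht')

end OrbmTestData

end Literature.Probability.RandomPlanarGeometry
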